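import Summits.HodgeConjecture.CorCM.MumfordTateRankCurveTimesSurface
import Summits.HodgeConjecture.CorCM.MumfordTateRankThreeCurves
import Summits.HodgeConjecture.CorCM.MumfordTateRankThreefolds
import Summits.HodgeConjecture.CorCM.MumfordTateRankThreeClassification
import Summits.HodgeConjecture.CorCM.MumfordTateRankOfCMAbelianVariety
import Summits.HodgeConjecture.HodgeConjecture.Theorems.CorCMDominationCMProduct
import Literature.AlgebraicGeometry.Milne1999.CMTypeSimpleIsogenyFactors
import HarnessLib

/-!
# Every complex abelian THREEFOLD has `dim MT(H¹X) ∈ {2, 3, 4, 5, 6, 7, 8, 10, 12, 14, 22}` — the ranks `9, 11, 13` do not occur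

COR-CM (cell `pub-hodgecm2`, seat `b27` gen 47, count-neutral Mumford–Tate-rank ladder; theorems only, no definition, no named fact;
UNCONDITIONAL — nothing here uses or asserts HC_CM).  Sequel of `CorCM/MumfordTateRankThreefolds` (`t ≤ 14` or `t = 22`): with the
curve × simple-surface table (`CorCM/MumfordTateRankCurveTimesSurface`), the three-curve values (`CorCM/MumfordTateRankThreeCurves`) and
the product formulas of Moonen–Zarhin Thm. (3.2)(2), the rank of a NON-simple threefold is one of `2, 3, 4, 5, 6, 7, 8, 10, 12, 14`:

* `mtRank_hodge_one_eq_four_of_isIsogenous_cmCurve_prod_cmSurface` — CM curve × simple CM surface: `t = 4` EXACTLY (`t ≤ 4` by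
  subadditivity; `t ∈ {2, 3}` would make `X` a power of one curve / of one simple CM surface / a product of two CM curves — the closed
  forms of the rungs `2` and `3` — contradicting the uniqueness of simple factors);
* `mtRank_hodge_one_mem_of_isIsogenous_prod_three_curves` — `X ∼ E₀ × E₁ × E₂`: `t ∈ {2, 3, 4, 5, 6, 7, 8, 10}`;
* **`mtRank_hodge_one_mem_of_threefold`** — every abelian threefold: `t ∈ {2, 3, 4, 5, 6, 7, 8, 10, 12, 14, 22}`;
  `mtRank_hodge_one_not_mem_of_threefold` — `t ∉ {9, 11, 13}` and `t ∉ [15, 21]`.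

## References
* [MoonenZarhin1999LowDim] B. Moonen, Yu. G. Zarhin, Math. Ann. 315 (1999), §2 (2.2)–(2.3), §3 (3.1)–(3.4).
  [cite: MoonenZarhin1999LowDim, §2 (2.3) and §3 Thm. (3.2)(2)]
* [MumfordAV1970] D. Mumford, *Abelian Varieties*, §19 Thm. 1 and Cor. 1 (Poincaré reducibility, uniqueness of simple factors).
  [cite: MumfordAV1970, §19 Thm. 1]
-/

noncomputable section

open scoped TensorProduct
open CategoryTheory CategoryTheory.Limits Module

namespace Summit.HodgeConjecture.CorCM

open Literature.AlgebraicGeometry.Motives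
open Literature.AlgebraicGeometry.Motives.AbelianVariety
open Literature.AlgebraicGeometry.Motives.HodgeStructure
open Literature.AlgebraicGeometry.HodgeTheory
open Literature.AlgebraicGeometry.Milne1999 (IsOfCMType isOfCMType_iff_of_isIsogenous)
open Literature.AlgebraicGeometry.Pohlmann1968 (isIsogenous_powSucc_biproduct)
open Summit.HodgeConjecture.CorCM.Domination

variable [HodgeTensorFacts.{0, 0}] {X : AbelianVariety ℂ} {n : ℕ}

/-! ## §0 Plumbing -/

omit [HodgeTensorFacts.{0, 0}] in
/-- `A × (B × C) ∼ (A × B) × C`. [cite: MumfordAV1970, §19] -/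
theorem isIsogenous_prod_assoc (A B C : AbelianVariety ℂ) : IsIsogenous (A.prod (B.prod C)) ((A.prod B).prod C) :=
  ⟨(prodAssoc A B C).hom, isIsogeny_hom_of_iso (prodAssoc A B C)⟩

omit [HodgeTensorFacts.{0, 0}] in
/-- `E₀ × (E₁ × E₂) ∼ ⨁_{Fin 3} ![E₀, E₁, E₂]`. [cite: MumfordAV1970, §19] -/
theorem isIsogenous_prod_prod_biproduct_three (E₀ E₁ E₂ : AbelianVariety ℂ) :
    IsIsogenous (E₀.prod (E₁.prod E₂)) (⨁ (![E₀, E₁, E₂] : Fin 3 → AbelianVariety ℂ)) :=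
  (biproduct_three_isIsogenous_prod_prod ![E₀, E₁, E₂]).symm'

/-! ## §1 CM curve × simple CM surface: `t = 4` -/

/-- **`t(E × S) = 4` for a CM elliptic curve `E` and a simple CM surface `S`.**  `t ≤ 4` (`t + 1 ≤ 2 + 3`); `t = 2` would make `X` a
power of a curve and `t = 3` a power of a simple CM surface or a product of CM curves (`mtRank_hodge_one_eq_two_iff`,
`mtRank_hodge_one_eq_three_iff_surface_or_elliptic`), and the simple factors `E`, `S` of `X` would then be isogenous to factors of the
wrong dimension. [cite: MoonenZarhin1999LowDim, §2 (2.2) and §3] [cite: MumfordAV1970, §19 Thm. 1] -/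
theorem mtRank_hodge_one_eq_four_of_isIsogenous_cmCurve_prod_cmSurface (hX : IsSmoothProjective n X.X) {E S : AbelianVariety ℂ}
    (hE1 : E.dim = 1) (hcm : IsOfCMType E) (hSs : S.IsSimple) (hS2 : S.dim = 2) (hScm : IsOfCMType S)
    (hXP : IsIsogenous X (E.prod S)) :
    haveI := BettiUniverse.finite hX 1
    (BettiUniverse.hodge exists_isReal_hodgeModel_holds hX 1).mtRank = 4 := by
  classical
  have hE : IsSmoothProjective E.dim E.X := AbelianVariety.isSmoothProjective_holds
  have hS : IsSmoothProjective S.dim S.X := AbelianVariety.isSmoothProjective_holds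
  haveI := BettiUniverse.finite hX 1
  haveI := BettiUniverse.finite hE 1
  haveI := BettiUniverse.finite hS 1
  obtain ⟨g, hg⟩ := hXP
  have h0 : 0 < X.dim := by rw [dim_eq_of_isIsogeny hg, dim_prod]; omega
  have h2 := mtRank_hodge_one_eq_two_of_cm_curve hE1 hcm
  have h3 := (isOfCMType_iff_mtRank_hodge_one_eq_three_of_isSimple_surface hS hSs hS2).1 hScm
  have hle := mtRank_hodge_one_add_one_le_add_of_isIsogenous_prod hE hS (by omega) (by omega) hX ⟨g, hg⟩
  have hge := two_le_mtRank_hodge_one hX h0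
  have hEs : E.IsSimple := isSimple_of_dim_le_one hE1.le
  have hEX : AVDominatedBy E X := (SliceExhaustion.avDominatedBy_prod_left E S).trans_isIsogeny_inv hg
  have hSX : AVDominatedBy S X := (avDominatedBy_prod_right E S).trans_isIsogeny_inv hg
  -- `t ≠ 2`
  have hne2 : (BettiUniverse.hodge exists_isReal_hodgeModel_holds hX 1).mtRank ≠ 2 := fun h => by
    obtain ⟨E₀, N, hE₀1, -, ⟨f, hf⟩⟩ := (mtRank_hodge_one_eq_two_iff hX h0).1 h
    obtain ⟨f', hf'⟩ := isIsogenous_powSucc_biproduct E₀ N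
    obtain ⟨-, hSE₀⟩ := exists_isIsogenous_of_isSimple_of_avDominatedBy_biproduct (fun _ => isSimple_of_dim_le_one hE₀1.le) hSs
      (by omega) ((hSX.trans_isIsogeny_hom hf).trans_isIsogeny_hom hf')
    obtain ⟨u, hu⟩ := hSE₀
    have := dim_eq_of_isIsogeny hu
    omega
  -- `t ≠ 3`
  have hne3 : (BettiUniverse.hodge exists_isReal_hodgeModel_holds hX 1).mtRank ≠ 3 := fun h => by
    rcases (mtRank_hodge_one_eq_three_iff_surface_or_elliptic hX h0).1 h with ⟨S', hS's, hS'2, -, N, ⟨f, hf⟩⟩ | ⟨E', hE'1, -, -, m, cls, -, ⟨f, hf⟩⟩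
    · obtain ⟨f', hf'⟩ := isIsogenous_powSucc_biproduct S' N
      obtain ⟨-, hES'⟩ := exists_isIsogenous_of_isSimple_of_avDominatedBy_biproduct (fun _ => hS's) hEs (by omega)
        ((hEX.trans_isIsogeny_hom hf).trans_isIsogeny_hom hf')
      obtain ⟨u, hu⟩ := hES'
      have := dim_eq_of_isIsogeny hu
      omega
    · obtain ⟨j, hSE'⟩ := exists_isIsogenous_of_isSimple_of_avDominatedBy_biproduct
        (fun j => isSimple_of_dim_le_one (hE'1 (cls j)).le) hSs (by omega) (hSX.trans_isIsogeny_hom hf)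
      obtain ⟨u, hu⟩ := hSE'
      have := dim_eq_of_isIsogeny hu
      have := hE'1 (cls j)
      omega
  omega

/-! ## §2 Products of three elliptic curves: `t ∈ {2, 3, 4, 5, 6, 7, 8, 10}` -/

/-- **`X ∼ E₀ × E₁ × E₂` (elliptic curves, isogenous or not): `dim MT(H¹X) ∈ {2, 3, 4, 5, 6, 7, 8, 10}`.**  All CM: `2 ≤ t ≤ dim + 1 = 4`.
One or two CM curves: `t + 1 = t(non-CM part) + t(CM part)` (Moonen–Zarhin Thm. (3.2)(2)) with `t(E) ∈ {2, 4}`,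
`t(E × E') ∈ {2, 3, 4, 5, 7}`.  No CM curve: `t = 10` for pairwise non-isogenous curves (`CorCM/MumfordTateRankThreeCurves`), otherwise
`t + 1 ≤ 4 + 4` and `t ∉ {5, 6}` (no factor of type IV). [cite: MoonenZarhin1999LowDim, §3 Thm. (3.2)(2) and (3.4)] -/
theorem mtRank_hodge_one_mem_of_isIsogenous_prod_three_curves (hX : IsSmoothProjective n X.X) {E₀ E₁ E₂ : AbelianVariety ℂ}
    (hE₀ : E₀.dim = 1) (hE₁ : E₁.dim = 1) (hE₂ : E₂.dim = 1) (hXP : IsIsogenous X (E₀.prod (E₁.prod E₂))) :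
    haveI := BettiUniverse.finite hX 1
    (BettiUniverse.hodge exists_isReal_hodgeModel_holds hX 1).mtRank = 2 ∨ (BettiUniverse.hodge exists_isReal_hodgeModel_holds hX 1).mtRank = 3 ∨
      (BettiUniverse.hodge exists_isReal_hodgeModel_holds hX 1).mtRank = 4 ∨ (BettiUniverse.hodge exists_isReal_hodgeModel_holds hX 1).mtRank = 5 ∨
      (BettiUniverse.hodge exists_isReal_hodgeModel_holds hX 1).mtRank = 6 ∨ (BettiUniverse.hodge exists_isReal_hodgeModel_holds hX 1).mtRank = 7 ∨
      (BettiUniverse.hodge exists_isReal_hodgeModel_holds hX 1).mtRank = 8 ∨ (BettiUniverse.hodge exists_isReal_hodgeModel_holds hX 1).mtRank = 10 := by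
  classical
  have hsp : ∀ A : AbelianVariety ℂ, IsSmoothProjective A.dim A.X := fun A => AbelianVariety.isSmoothProjective_holds
  haveI := BettiUniverse.finite hX 1
  haveI : ∀ A : AbelianVariety ℂ, Module.Finite ℚ (bettiCohomology A.X 1) := fun A => BettiUniverse.finite (hsp A) 1
  set t := (BettiUniverse.hodge exists_isReal_hodgeModel_holds hX 1).mtRank with ht
  have h0 : 0 < X.dim := by
    obtain ⟨g, hg⟩ := hXP; rw [dim_eq_of_isIsogeny hg, dim_prod, dim_prod]; omega
  have hge := two_le_mtRank_hodge_one hX h0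
  -- the pair tables
  have pair := fun (A B : AbelianVariety ℂ) (hA : A.dim = 1) (hB : B.dim = 1) =>
    mtRank_hodge_one_of_isIsogenous_prod_curves (hsp (A.prod B)) hA hB (IsIsogenous.refl _)
  -- regroupings of `E₀ × (E₁ × E₂)`
  have r01_2 : IsIsogenous X ((E₀.prod E₁).prod E₂) := hXP.trans (isIsogenous_prod_assoc _ _ _)
  have r02_1 : IsIsogenous X ((E₀.prod E₂).prod E₁) :=
    (hXP.trans ((IsIsogenous.refl E₀).prod (isIsogenous_prod_comm E₁ E₂))).trans (isIsogenous_prod_assoc _ _ _)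
  have r12_0 : IsIsogenous X ((E₁.prod E₂).prod E₀) := hXP.trans (isIsogenous_prod_comm _ _)
  by_cases c₀ : IsOfCMType E₀ <;> by_cases c₁ : IsOfCMType E₁ <;> by_cases c₂ : IsOfCMType E₂
  · -- all CM
    have hcm : IsOfCMType X := (isOfCMType_iff_of_isIsogenous hXP).2 (c₀.prod (c₁.prod c₂))
    have hle := mtRank_hodge_one_le_dim_add_one_of_isOfCMType hX h0 hcm
    have hd : X.dim = 3 := by obtain ⟨g, hg⟩ := hXP; rw [dim_eq_of_isIsogeny hg, dim_prod, dim_prod]; omega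
    omega
  · -- E₀, E₁ CM; E₂ not: `X ∼ E₂ × (E₀ × E₁)`
    obtain ⟨h4, -, hA4, -⟩ := curve_facts_of_not_isOfCMType hE₂ c₂
    have h := mtRank_hodge_one_add_one_eq_add_of_isIsogenous_prod hX (hsp E₂) (hsp (E₀.prod E₁)) (by omega)
      (by rw [dim_prod]; omega) hA4 (c₀.prod c₁) (r01_2.trans (isIsogenous_prod_comm _ _))
    rcases pair E₀ E₁ hE₀ hE₁ with ⟨-, -, -, hp⟩ | ⟨-, -, -, hp⟩ | ⟨hn, -⟩ | ⟨hn, -⟩ | ⟨hn, -⟩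
    · omega
    · omega
    · exact absurd c₀ hn
    · exact absurd (iff_of_true c₀ c₁) hn
    · exact absurd c₀ hn
  · -- E₀, E₂ CM; E₁ not: `X ∼ E₁ × (E₀ × E₂)`
    obtain ⟨h4, -, hA4, -⟩ := curve_facts_of_not_isOfCMType hE₁ c₁
    have h := mtRank_hodge_one_add_one_eq_add_of_isIsogenous_prod hX (hsp E₁) (hsp (E₀.prod E₂)) (by omega)
      (by rw [dim_prod]; omega) hA4 (c₀.prod c₂) (r02_1.trans (isIsogenous_prod_comm _ _))
    rcases pair E₀ E₂ hE₀ hE₂ with ⟨-, -, -, hp⟩ | ⟨-, -, -, hp⟩ | ⟨hn, -⟩ | ⟨hn, -⟩ | ⟨hn, -⟩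
    · omega
    · omega
    · exact absurd c₀ hn
    · exact absurd (iff_of_true c₀ c₂) hn
    · exact absurd c₀ hn
  · -- E₀ CM; E₁, E₂ not: `X ∼ (E₁ × E₂) × E₀`
    obtain ⟨-, -, hA1, -⟩ := curve_facts_of_not_isOfCMType hE₁ c₁
    obtain ⟨-, -, hA2, -⟩ := curve_facts_of_not_isOfCMType hE₂ c₂
    have htwo := mtRank_hodge_one_eq_two_of_cm_curve hE₀ c₀
    have h := mtRank_hodge_one_add_one_eq_add_of_isIsogenous_prod hX (hsp (E₁.prod E₂)) (hsp E₀) (by rw [dim_prod]; omega)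
      (by omega) (hA1.prod hA2) c₀ r12_0
    rcases pair E₁ E₂ hE₁ hE₂ with ⟨hc, -⟩ | ⟨hc, -⟩ | ⟨-, -, -, hp⟩ | ⟨hn, -⟩ | ⟨-, -, -, hp⟩
    · exact absurd hc c₁
    · exact absurd hc c₁
    · omega
    · exact absurd (iff_of_false c₁ c₂) hn
    · omega
  · -- E₁, E₂ CM; E₀ not: `X ∼ E₀ × (E₁ × E₂)`
    obtain ⟨h4, -, hA4, -⟩ := curve_facts_of_not_isOfCMType hE₀ c₀
    have h := mtRank_hodge_one_add_one_eq_add_of_isIsogenous_prod hX (hsp E₀) (hsp (E₁.prod E₂)) (by omega)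
      (by rw [dim_prod]; omega) hA4 (c₁.prod c₂) hXP
    rcases pair E₁ E₂ hE₁ hE₂ with ⟨-, -, -, hp⟩ | ⟨-, -, -, hp⟩ | ⟨hn, -⟩ | ⟨hn, -⟩ | ⟨hn, -⟩
    · omega
    · omega
    · exact absurd c₁ hn
    · exact absurd (iff_of_true c₁ c₂) hn
    · exact absurd c₁ hn
  · -- E₁ CM; E₀, E₂ not: `X ∼ (E₀ × E₂) × E₁`
    obtain ⟨-, -, hA0, -⟩ := curve_facts_of_not_isOfCMType hE₀ c₀
    obtain ⟨-, -, hA2, -⟩ := curve_facts_of_not_isOfCMType hE₂ c₂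
    have htwo := mtRank_hodge_one_eq_two_of_cm_curve hE₁ c₁
    have h := mtRank_hodge_one_add_one_eq_add_of_isIsogenous_prod hX (hsp (E₀.prod E₂)) (hsp E₁) (by rw [dim_prod]; omega)
      (by omega) (hA0.prod hA2) c₁ r02_1
    rcases pair E₀ E₂ hE₀ hE₂ with ⟨hc, -⟩ | ⟨hc, -⟩ | ⟨-, -, -, hp⟩ | ⟨hn, -⟩ | ⟨-, -, -, hp⟩
    · exact absurd hc c₀
    · exact absurd hc c₀
    · omega
    · exact absurd (iff_of_false c₀ c₂) hn
    · omega
  · -- E₂ CM; E₀, E₁ not: `X ∼ (E₀ × E₁) × E₂`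
    obtain ⟨-, -, hA0, -⟩ := curve_facts_of_not_isOfCMType hE₀ c₀
    obtain ⟨-, -, hA1, -⟩ := curve_facts_of_not_isOfCMType hE₁ c₁
    have htwo := mtRank_hodge_one_eq_two_of_cm_curve hE₂ c₂
    have h := mtRank_hodge_one_add_one_eq_add_of_isIsogenous_prod hX (hsp (E₀.prod E₁)) (hsp E₂) (by rw [dim_prod]; omega)
      (by omega) (hA0.prod hA1) c₂ r01_2
    rcases pair E₀ E₁ hE₀ hE₁ with ⟨hc, -⟩ | ⟨hc, -⟩ | ⟨-, -, -, hp⟩ | ⟨hn, -⟩ | ⟨-, -, -, hp⟩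
    · exact absurd hc c₀
    · exact absurd hc c₀
    · omega
    · exact absurd (iff_of_false c₀ c₁) hn
    · omega
  · -- no CM curve
    obtain ⟨h40, -, hA0, -⟩ := curve_facts_of_not_isOfCMType hE₀ c₀
    obtain ⟨h41, -, hA1, -⟩ := curve_facts_of_not_isOfCMType hE₁ c₁
    obtain ⟨h42, -, hA2, -⟩ := curve_facts_of_not_isOfCMType hE₂ c₂
    have hA4 : HasNoTypeIVFactor X := (hA0.prod (hA1.prod hA2)).of_isIsogenous hXP
    have hne := mtRank_hodge_one_ne_of_hasNoTypeIVFactor hX h0 hA4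
    have hge4 := four_le_mtRank_hodge_one_of_not_isOfCMType hX (not_isOfCMType_of_hasNoTypeIVFactor hX h0 hA4)
    by_cases h01 : IsIsogenous E₀ E₁
    · have h4 := mtRank_hodge_one_eq_four_of_isIsogenous_prod_curves (hsp (E₀.prod E₁)) hE₀ c₀ h01 (IsIsogenous.refl _)
      have h := mtRank_hodge_one_add_one_le_add_of_isIsogenous_prod (hsp (E₀.prod E₁)) (hsp E₂) (by rw [dim_prod]; omega) (by omega)
        hX r01_2
      omega
    by_cases h02 : IsIsogenous E₀ E₂
    · have h4 := mtRank_hodge_one_eq_four_of_isIsogenous_prod_curves (hsp (E₀.prod E₂)) hE₀ c₀ h02 (IsIsogenous.refl _)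
      have h := mtRank_hodge_one_add_one_le_add_of_isIsogenous_prod (hsp (E₀.prod E₂)) (hsp E₁) (by rw [dim_prod]; omega) (by omega)
        hX r02_1
      omega
    by_cases h12 : IsIsogenous E₁ E₂
    · have h4 := mtRank_hodge_one_eq_four_of_isIsogenous_prod_curves (hsp (E₁.prod E₂)) hE₁ c₁ h12 (IsIsogenous.refl _)
      have h := mtRank_hodge_one_add_one_le_add_of_isIsogenous_prod (hsp (E₁.prod E₂)) (hsp E₀) (by rw [dim_prod]; omega) (by omega)
        hX r12_0
      omega
    · have h10 := mtRank_hodge_one_eq_ten_of_biproduct_three_nonCM_curves hX (E := ![E₀, E₁, E₂])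
        (fun j => by fin_cases j <;> assumption) (fun j => by fin_cases j <;> assumption)
        (fun j l hjl => by
          fin_cases j <;> fin_cases l
          · exact absurd rfl hjl
          · exact h01
          · exact h02
          · exact fun h => h01 h.symm'
          · exact absurd rfl hjl
          · exact h12
          · exact fun h => h02 h.symm'
          · exact fun h => h12 h.symm'
          · exact absurd rfl hjl)
        (hXP.trans (isIsogenous_prod_prod_biproduct_three E₀ E₁ E₂))
      omega

/-! ## §3 Every abelian threefold -/

/-- **The Mumford–Tate rank of a complex abelian THREEFOLD is one of `2, 3, 4, 5, 6, 7, 8, 10, 12, 14, 22`.**  Simple: `4, 10, 22`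
(`CorCM/MumfordTateRankSimpleThreefolds`); `E × S` with `S` simple: `4` (CM × CM), `5, 8, 12` (CM × non-CM), `6, 7, 10, 14` (non-CM ×
CM / QM / RM / `End⁰ = ℚ`); `E₀ × E₁ × E₂`: `2, …, 8, 10`. [cite: MoonenZarhin1999LowDim, §2 (2.3) and §3 Thm. (3.2)(2)] -/
theorem mtRank_hodge_one_mem_of_threefold (hX : IsSmoothProjective n X.X) (hX3 : X.dim = 3) :
    haveI := BettiUniverse.finite hX 1
    (BettiUniverse.hodge exists_isReal_hodgeModel_holds hX 1).mtRank = 2 ∨ (BettiUniverse.hodge exists_isReal_hodgeModel_holds hX 1).mtRank = 3 ∨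
      (BettiUniverse.hodge exists_isReal_hodgeModel_holds hX 1).mtRank = 4 ∨ (BettiUniverse.hodge exists_isReal_hodgeModel_holds hX 1).mtRank = 5 ∨
      (BettiUniverse.hodge exists_isReal_hodgeModel_holds hX 1).mtRank = 6 ∨ (BettiUniverse.hodge exists_isReal_hodgeModel_holds hX 1).mtRank = 7 ∨
      (BettiUniverse.hodge exists_isReal_hodgeModel_holds hX 1).mtRank = 8 ∨ (BettiUniverse.hodge exists_isReal_hodgeModel_holds hX 1).mtRank = 10 ∨
      (BettiUniverse.hodge exists_isReal_hodgeModel_holds hX 1).mtRank = 12 ∨ (BettiUniverse.hodge exists_isReal_hodgeModel_holds hX 1).mtRank = 14 ∨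
      (BettiUniverse.hodge exists_isReal_hodgeModel_holds hX 1).mtRank = 22 := by
  classical
  haveI := BettiUniverse.finite hX 1
  set t := (BettiUniverse.hodge exists_isReal_hodgeModel_holds hX 1).mtRank with ht
  by_cases hs : X.IsSimple
  · rcases mtRank_hodge_one_mem_of_isSimple_threefold hX hs hX3 with h | h | h <;> omega
  obtain ⟨E, S, hE1, hS2, hES⟩ := exists_curve_prod_surface_isIsogenous_of_not_isSimple_threefold hX3 hs
  have hXP : IsIsogenous X (E.prod S) := hES.symm'
  have hS : IsSmoothProjective S.dim S.X := AbelianVariety.isSmoothProjective_holds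
  haveI := BettiUniverse.finite hS 1
  by_cases hSs : S.IsSimple
  · by_cases hEcm : IsOfCMType E <;> by_cases hScm : IsOfCMType S
    · have h := mtRank_hodge_one_eq_four_of_isIsogenous_cmCurve_prod_cmSurface hX hE1 hEcm hSs hS2 hScm hXP; omega
    · rcases mtRank_hodge_one_of_isIsogenous_cmCurve_prod_isSimple_surface hX hE1 hEcm hSs hS2 hScm hXP with ⟨-, h⟩ | ⟨-, h⟩ | ⟨-, h⟩ <;>
        omega
    · have h := mtRank_hodge_one_eq_six_of_isIsogenous_curve_prod_cmSurface hX hE1 hEcm hSs hS2 hScm hXP; omega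
    · rcases mtRank_hodge_one_of_isSimple_surface_sharp hS hSs hS2 with ⟨h1, -⟩ | ⟨h2, -⟩ | ⟨-, -, hcm', -⟩ | ⟨h4, -, -⟩
      · have h := mtRank_hodge_one_eq_fourteen_of_isIsogenous_curve_prod_surface_endRankOne hX hE1 hEcm hS2 h1 hXP; omega
      · have h := mtRank_hodge_one_eq_ten_of_isIsogenous_curve_prod_rmSurface hX hE1 hEcm hSs hS2 h2 hXP; omega
      · exact absurd hcm' hScm
      · have h := mtRank_hodge_one_eq_seven_of_isIsogenous_curve_prod_qmSurface hX hE1 hEcm hSs hS2 h4 hScm hXP; omega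
  · obtain ⟨E', E'', hE'1, hE''1, hSE⟩ := exists_isIsogenous_prod_of_not_isSimple_surface hS2 hSs
    have hXP3 : IsIsogenous X (E.prod (E'.prod E'')) := hXP.trans ((IsIsogenous.refl E).prod hSE)
    rcases mtRank_hodge_one_mem_of_isIsogenous_prod_three_curves hX hE1 hE'1 hE''1 hXP3 with h | h | h | h | h | h | h | h <;> omega

/-- **No complex abelian threefold has Mumford–Tate rank `9`, `11`, `13`, or in `[15, 21]`.** [cite: MoonenZarhin1999LowDim, §2 (2.3) and §3] -/
theorem mtRank_hodge_one_not_mem_of_threefold (hX : IsSmoothProjective n X.X) (hX3 : X.dim = 3) :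
    haveI := BettiUniverse.finite hX 1
    (BettiUniverse.hodge exists_isReal_hodgeModel_holds hX 1).mtRank ≠ 9 ∧ (BettiUniverse.hodge exists_isReal_hodgeModel_holds hX 1).mtRank ≠ 11 ∧
      (BettiUniverse.hodge exists_isReal_hodgeModel_holds hX 1).mtRank ≠ 13 ∧
      ¬ (15 ≤ (BettiUniverse.hodge exists_isReal_hodgeModel_holds hX 1).mtRank ∧ (BettiUniverse.hodge exists_isReal_hodgeModel_holds hX 1).mtRank ≤ 21) := by
  rcases mtRank_hodge_one_mem_of_threefold hX hX3 with h | h | h | h | h | h | h | h | h | h | h <;> omega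

end Summit.HodgeConjecture.CorCM

end
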